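import Mathlib.LinearAlgebra.Matrix.NonsingularInverse
import Mathlib.LinearAlgebra.FiniteDimensional.Defs
import Mathlib.LinearAlgebra.Dimension.Constructions
import Mathlib.LinearAlgebra.LinearIndependent.Lemmas
import Mathlib.Algebra.Field.ZMod

/-!
# Spanning over `ℚ` from spanning modulo a prime (registered stub `stub_modBridge`)

The bridge that turns a certificate computed MODULO A PRIME into a statement over `ℚ`: if `S` is a family of
integer vectors on a finite index type whose reductions modulo a prime `p` span `(ZMod p)^ι`, then their images
span `ℚ^ι`.  Proof: choose a basis of `(ZMod p)^ι` inside the reductions, lift it to `|ι|` vectors of `S`,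
forming a square integer matrix `M`; its reduction has linearly independent rows, so `det M ≢ 0 (mod p)`, so
`det M ≠ 0`, so `M` is invertible over `ℚ` and its rows — images of elements of `S` — span `ℚ^ι`.
(Equivalently: the rank of an integer matrix can only drop under reduction.)  Used by the EDS certificate
tables of weight `≥ 11` of the line `Sketch` of the crux `LinRedNormalForm.HoffmanSpanInKZ`, whose elimination
transcripts are checked by the kernel in `ZMod p` (small numbers) instead of `ℚ` (60–280-digit rationals).

Sources: folklore (rank inequality `rank_𝔽ₚ(M mod p) ≤ rank_ℚ(M)` for integer matrices); Mathlib's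
`Matrix.linearIndependent_rows_iff_isUnit`, `Matrix.vecMul_surjective_iff_isUnit`, `RingHom.map_det`. [folklore]
-/

namespace Summit.KontsevichZagierPeriods.LinRedNormalForm.HoffmanSpanInKZ

open Submodule

/-- The reduction of an integer vector modulo `p`. [folklore] -/
def redP (p : ℕ) {ι : Type*} (v : ι → ℤ) : ι → ZMod p := fun i => (v i : ZMod p)

/-- The image of an integer vector in `ℚ^ι`. [folklore] -/
def toQ {ι : Type*} (v : ι → ℤ) : ι → ℚ := fun i => (v i : ℚ)

/-- **Spanning modulo a prime implies spanning over `ℚ`.**  If the reductions modulo a prime `p` of a family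
`S` of integer vectors span `(ZMod p)^ι` (`ι` finite), then the rational images of `S` span `ℚ^ι`. [folklore] -/
theorem span_toQ_eq_top_of_span_redP_eq_top {ι : Type*} [Fintype ι] [DecidableEq ι] (p : ℕ) [Fact p.Prime]
    (S : Set (ι → ℤ)) (h : span (ZMod p) (redP p '' S) = ⊤) : span ℚ (toQ '' S) = ⊤ := by
  classical
  obtain ⟨b, hbT, hbspan, hblin⟩ := exists_linearIndependent (ZMod p) (redP p '' S)
  have hbtop : ⊤ ≤ span (ZMod p) (Set.range ((↑) : b → ι → ZMod p)) := by
    rw [Subtype.range_coe, hbspan, h]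
  let B : Module.Basis b (ZMod p) (ι → ZMod p) := Module.Basis.mk hblin hbtop
  haveI : Fintype b := FiniteDimensional.fintypeBasisIndex B
  have hcard : Fintype.card ι = Fintype.card b := by
    rw [← Module.finrank_eq_card_basis B, Module.finrank_fintype_fun_eq_card]
  let e : ι ≃ b := Fintype.equivOfCardEq hcard
  have hpre : ∀ x : b, ∃ s ∈ S, redP p s = (x : ι → ZMod p) := fun x =>
    (Set.mem_image _ _ _).1 (hbT x.2)
  choose pre hpreS hpre_eq using hpre
  let M : Matrix ι ι ℤ := fun i => pre (e i)
  -- the reduction of `M` has the basis vectors as rows, hence is invertible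
  have hrows : (M.map (Int.castRingHom (ZMod p))).row = ((↑) : b → ι → ZMod p) ∘ e := by
    funext i j
    show ((pre (e i) j : ℤ) : ZMod p) = ((e i : b) : ι → ZMod p) j
    exact congrFun (hpre_eq (e i)) j
  have hMp : IsUnit (M.map (Int.castRingHom (ZMod p))) := by
    rw [← Matrix.linearIndependent_rows_iff_isUnit, hrows]
    exact hblin.comp _ e.injective
  have hdetp : IsUnit ((Int.castRingHom (ZMod p)) M.det) := by
    rw [RingHom.map_det, RingHom.mapMatrix_apply]
    exact (Matrix.isUnit_iff_isUnit_det _).1 hMp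
  have hdet : M.det ≠ 0 := by
    intro h0
    rw [h0, map_zero] at hdetp
    exact not_isUnit_zero hdetp
  -- over `ℚ` the matrix is invertible, so its rows span
  let MQ : Matrix ι ι ℚ := M.map (Int.castRingHom ℚ)
  have hdetQ : IsUnit MQ.det := by
    rw [isUnit_iff_ne_zero]
    have : MQ.det = (Int.castRingHom ℚ) M.det := by
      rw [RingHom.map_det, RingHom.mapMatrix_apply]
    rw [this, eq_intCast, ne_eq, Int.cast_eq_zero]
    exact hdet
  have hMQ : IsUnit MQ := (Matrix.isUnit_iff_isUnit_det _).2 hdetQ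
  have hsurj := Matrix.vecMul_surjective_iff_isUnit.2 hMQ
  rw [eq_top_iff]
  rintro x -
  obtain ⟨v, rfl⟩ := hsurj x
  show Matrix.vecMul v MQ ∈ _
  have hsum : Matrix.vecMul v MQ = ∑ i, v i • MQ i := by
    funext j
    simp [Matrix.vecMul, dotProduct, Finset.sum_apply, smul_eq_mul]
  rw [hsum]
  refine sum_mem fun i _ => smul_mem _ _ (subset_span ⟨pre (e i), hpreS (e i), ?_⟩)
  funext j
  simp [MQ, M, toQ, Matrix.map_apply]

/-! ## The registered stub -/

/-- The bridge as a statement (not a published fact: a folklore rank inequality, proved above). -/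
def ModBridgeSound : Prop :=
  ∀ (ι : Type) [Fintype ι] [DecidableEq ι] (p : ℕ) [Fact p.Prime] (S : Set (ι → ℤ)),
    span (ZMod p) (redP p '' S) = ⊤ → span ℚ (toQ '' S) = ⊤

/-- **Registered stub `stub_modBridge`** of the skeleton of line `Sketch`. -/
theorem stub_modBridge : ModBridgeSound := fun _ _ _ p _ S h => span_toQ_eq_top_of_span_redP_eq_top p S h

end Summit.KontsevichZagierPeriods.LinRedNormalForm.HoffmanSpanInKZ
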